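import Summits.BirchSwinnertonDyer.BirchSwinnertonDyer.Theorems.AlignedTransportAtTwoOffStratumPartitionTwistFamilyZhaiTransport
import HarnessLib

/-!
# Route `AlignedTransportAtTwo`, crux C2 `MainConjectureOfRankZeroBSDAtTwo` (stmt-22298), line `birth` — PRINT-TRANSPORT of `BSD(W, 2)` on the whole
# `a_q`-odd twist class: the rows of the seeds `2071a1`, `4087a1`, `4087c1` (Kilford stratum) and `2045b1` (off-stratum)

HONEST FRAMING (cell `bsd-f1-sign2`, WIDTH-5 attach seat `bsd-line-att-p4` g24; `--supports stmt-BirchSwinnertonDyer-22298 --as helper`).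
THEOREMS ONLY (no `def`, no named fact, no `sorry`). BSD is NOT proved; C1/C2/C3′ are NOT closed; nothing is asserted — every row is CONDITIONAL
on the displayed PRINT named facts and the seed's displayed data. Sequel of `…TwistFamilyZhaiTransport` (same seat, same gen): its generic
`bsdp_two_twist_oddTrace_of_print` (U2's uniform rank-zero twist transport × `BSD(S, 2)`, the per-base Selmer binders derived from `BSD(S, 2)` +
Zhai's unit datum) instantiated at the four remaining small certified seeds, whose bad primes are all MULTIPLICATIVE with ODD discriminant
valuation (kernel-decided below from Cremona's models: `Δ(2071a1) = −19³·109`, `Δ(4087a1) = −61³·67⁵`, `Δ(4087c1) = −61·67`,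
`Δ(2045b1) = −5¹⁷·409`), so that Mazur–Rubin's splitting conditions are vacuous, and whose `BSD(S, 2)` is Creutz–Miller 2012 (PRINT, `N < 5000`).

Each row: for every square-free `d ≡ 1 (mod 4)`, `d ≠ 1`, `(d, N_S) = 1` with `a_q(S)` odd at every prime `q ∣ d`, and every globally minimal
model `W` of `S^{(d)}`: `r_an(W) = 0 ∧ rank W(ℚ) = 0 ∧ Ш(W)[2^∞] = 0 ∧ c(W)` odd `∧ BSD(W, 2)` — modulo PRINT⁷ {Zhai 2016 Thm. 1.1′/1.2′,
Mazur–Rubin 2010 Lemma 2.10, modularity, Abbes–Ullmo Thm. A, Creutz–Miller Thm. 1.1, GZK} + displayed {`Dt` an `X₀(N_S)`-optimality datum,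
`hL : ord₂(L(S,1)/Ω_∞(S)) = 0`}. NO Kato, NO Matsuno/Greenberg, NO tower-gap certificate, NO «bad primes split in `ℚ(√d)`».

PARTITION CURRENCY (D-0171): as in the parent file — for all five small seeds the whole Zhai class `T_Z` (a_q-odd form) has BSD₂ by
PRINT-TRANSPORT × print base with zero certificates; `MC₂` of the members stays on the cell road (that step is crux C2). Beyond-print theorem: no.
BSD is NOT proved.

References: [Zhai2016] Thm. 1.1; [MazurRubin2010] Lemma 2.10; [AbbesUllmo1996] Thm. A; [CreutzMiller2012] Thm. 1.1; [Miller2011LMS] Def. 1.1;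
[SilvermanAEC2009] VII.5 Prop. 5.1; [CremonaAlgorithms1997] Table 1.
-/

set_option autoImplicit false
set_option linter.dupNamespace false

noncomputable section

open scoped Classical

open WeierstrassCurve NumberField
open Literature.NumberTheory.EllipticCurves Literature.NumberTheory.EllipticCurves.ModularForms
open Literature.NumberTheory.EllipticCurves.Rank1Residual Literature.NumberTheory.EllipticCurves.Rank1Residual.Typed
open Literature.NumberTheory.EllipticCurves.CoatesLiTianZhai2015 Literature.NumberTheory.EllipticCurves.Zhai2016
open Summit.BirchSwinnertonDyer.Rank1Residual Summit.BirchSwinnertonDyer.Rank1Residual.X5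
open Summit.BirchSwinnertonDyer.Uniform
open Summit.BirchSwinnertonDyer.BirchSwinnertonDyer.Theorems.TowerClass
open Summit.BirchSwinnertonDyer.BirchSwinnertonDyer.Theorems.AlignedTransportAtTwoTwistFamilySmallSeeds
open Summit.BirchSwinnertonDyer.BirchSwinnertonDyer.Theorems.AlignedTransportAtTwoTwistFamilyZhaiTransport
open Summit.BirchSwinnertonDyer.BirchSwinnertonDyer.Theorems

namespace Summit.BirchSwinnertonDyer.BirchSwinnertonDyer.Theorems.AlignedTransportAtTwoTwistFamilyZhaiTransportSeeds

variable (W : WeierstrassCurve ℚ) [W.IsElliptic] [W.IsGloballyMinimal]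
  -- PRINT⁷ shared by every row
  (h11 : thm11_ordTwo_LAlg_twist_eq_zero') (h12 : thm12_ordTwo_LAlg_twist_eq_one')
  (hMR' : MazurRubin2010.d2_eq_of_lemma210_rat) (hmod : exists_isNewformOf)
  (hAU : abbesUllmo_not_dvd_maninConstant_of_not_dvd_level)
  (hCM : bsdTriple_of_rank_le_one_of_conductor_lt) (hGZK : rank_eq_analyticRank_of_analyticRank_le_one)

/-! ## `2071a1` (`N = 19·109`, `Δ = −19³·109`) -/

/-- The bad primes of `2071a1` are multiplicative with odd `ord_p Δ` (`3` at `19`, `1` at `109`). [cite: CremonaAlgorithms1997, Table 1] -/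
theorem bad_2071a1 : ∀ (p : ℕ) [Fact p.Prime], p ∣ c2071a1.conductorNorm ℤ →
    c2071a1.HasMultiplicativeReductionAtPrime p ∧ Odd (padicValRat p c2071a1.Δ) := by
  intro p hp hpN
  rw [conductorNorm_2071a1, show (2071 : ℕ) = 19 * 109 by norm_num] at hpN
  have hΔ : c2071a1.Δ = ((-747631 : ℤ) : ℚ) := by
    rw [show c2071a1.Δ = ((M2071a1.Δ : ℤ) : ℚ) from baseChange_int_Δ M2071a1, M2071a1_Δ]
  rcases (Nat.Prime.dvd_mul hp.out).mp hpN with h | h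
  · have hp' : p = 19 := (Nat.prime_dvd_prime_iff_eq hp.out (by norm_num)).mp h
    subst hp'
    refine ⟨hasMultiplicativeReductionAtPrime_2071a1 19 (Or.inl rfl), ?_⟩
    rw [hΔ, show ((-747631 : ℤ) : ℚ) = -(((19 : ℕ) : ℚ) ^ 3 * (109 : ℕ)) by norm_num, padicValRat_neg_pow_mul 3 (by norm_num)]
    decide
  · have hp' : p = 109 := (Nat.prime_dvd_prime_iff_eq hp.out (by norm_num)).mp h
    subst hp'
    refine ⟨hasMultiplicativeReductionAtPrime_2071a1 109 (Or.inr rfl), ?_⟩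
    rw [hΔ, show ((-747631 : ℤ) : ℚ) = -(((109 : ℕ) : ℚ) ^ 1 * (6859 : ℕ)) by norm_num, padicValRat_neg_pow_mul 1 (by norm_num)]
    decide

include h11 h12 hMR' hmod hAU hCM hGZK in
/-- **`BSD(W, 2)` PRINT-TRANSPORT on the whole `a_q`-odd twist class of `2071a1`** (every square-free `d ≡ 1 (mod 4)`, `d ≠ 1`, `(d, 2071) = 1`,
`a_q(2071a1)` odd ∀ prime `q ∣ d`; every globally minimal model `W` of `2071a1^{(d)}`), modulo PRINT⁷ + displayed {`Dt`, `hL`}. No Kato, no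
certificate, no split condition. CONDITIONAL; BSD is NOT proved. [cite: Zhai2016, Thm. 1.1] [cite: MazurRubin2010, Lemma 2.10] [cite: CreutzMiller2012, Thm. 1.1]
[cite: AbbesUllmo1996, Thm. A] [cite: Miller2011LMS, Def. 1.1] -/
theorem bsdp_two_twist_oddTrace_2071a1 [NeZero (c2071a1.conductorNorm ℤ)]
    (Dt : ModularParametrizationData c2071a1 (c2071a1.conductorNorm ℤ)) (hopt : Zhai2021.IsOptimalDatum c2071a1 Dt)
    (hL : ∃ x : ℚ, IsLAlg c2071a1 x ∧ x ≠ 0 ∧ padicValRat 2 x = 0)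
    {d : ℤ} (hsqf : Squarefree d) (hd1 : d ≠ 1) (hd4 : d % 4 = 1) (hgcd : Int.gcd d 2071 = 1)
    (hodd : ∀ q : ℕ, q.Prime → (q : ℤ) ∣ d → Odd (c2071a1.frobeniusTrace q))
    {c : VariableChange ℚ} (hc : c • c2071a1.quadraticTwist (d : ℚ) = W) :
    W.analyticRank = 0 ∧ W.mordellWeilRank = 0 ∧ AddCommGroup.primaryComponent W.sha 2 = ⊥ ∧ Odd W.tamagawaProduct ∧ BSDp W 2 := by
  have hE : hasEntireLFunction_rat := WeierstrassCurve.hasEntireLFunction_rat_of_exists_isNewformOf hmod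
  have hr : c2071a1.analyticRank = 0 := by
    obtain ⟨x, hx, hx0, -⟩ := hL
    exact analyticRank_eq_zero_of_isLAlg c2071a1 hE hx hx0
  exact bsdp_two_twist_oddTrace_of_print h11 h12 hMR' hmod hAU c2071a1 W Dt hopt (by rw [conductorNorm_2071a1]; norm_num) bad_2071a1
    irr_two_2071a1 Δ_2071a1_neg' (bsdp_two_2071a1_of_creutzMiller hCM hGZK hr) hL hsqf hd1 hd4 (by rwa [conductorNorm_2071a1]) hodd hc

/-! ## `4087a1` (`N = 61·67`, `Δ = −61³·67⁵`) -/

/-- The bad primes of `4087a1` are multiplicative with odd `ord_p Δ` (`3` at `61`, `5` at `67`). [cite: CremonaAlgorithms1997, Table 1] -/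
theorem bad_4087a1 : ∀ (p : ℕ) [Fact p.Prime], p ∣ c4087a1.conductorNorm ℤ →
    c4087a1.HasMultiplicativeReductionAtPrime p ∧ Odd (padicValRat p c4087a1.Δ) := by
  intro p hp hpN
  rw [conductorNorm_4087a1, show (4087 : ℕ) = 61 * 67 by norm_num] at hpN
  have hΔ : c4087a1.Δ = ((-306452746911967 : ℤ) : ℚ) := by
    rw [show c4087a1.Δ = ((M4087a1.Δ : ℤ) : ℚ) from baseChange_int_Δ M4087a1, M4087a1_Δ]
  rcases (Nat.Prime.dvd_mul hp.out).mp hpN with h | h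
  · have hp' : p = 61 := (Nat.prime_dvd_prime_iff_eq hp.out (by norm_num)).mp h
    subst hp'
    refine ⟨hasMultiplicativeReductionAtPrime_4087a1 61 (Or.inl rfl), ?_⟩
    rw [hΔ, show ((-306452746911967 : ℤ) : ℚ) = -(((61 : ℕ) : ℚ) ^ 3 * (1350125107 : ℕ)) by norm_num,
      padicValRat_neg_pow_mul 3 (by norm_num)]
    decide
  · have hp' : p = 67 := (Nat.prime_dvd_prime_iff_eq hp.out (by norm_num)).mp h
    subst hp'
    refine ⟨hasMultiplicativeReductionAtPrime_4087a1 67 (Or.inr rfl), ?_⟩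
    rw [hΔ, show ((-306452746911967 : ℤ) : ℚ) = -(((67 : ℕ) : ℚ) ^ 5 * (226981 : ℕ)) by norm_num,
      padicValRat_neg_pow_mul 5 (by norm_num)]
    decide

include h11 h12 hMR' hmod hAU hCM hGZK in
/-- **`BSD(W, 2)` PRINT-TRANSPORT on the whole `a_q`-odd twist class of `4087a1`** (`(d, 4087) = 1`), modulo PRINT⁷ + displayed {`Dt`, `hL`}.
No Kato, no certificate, no split condition. CONDITIONAL; BSD is NOT proved. [cite: Zhai2016, Thm. 1.1] [cite: MazurRubin2010, Lemma 2.10]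
[cite: CreutzMiller2012, Thm. 1.1] [cite: AbbesUllmo1996, Thm. A] [cite: Miller2011LMS, Def. 1.1] -/
theorem bsdp_two_twist_oddTrace_4087a1 [NeZero (c4087a1.conductorNorm ℤ)]
    (Dt : ModularParametrizationData c4087a1 (c4087a1.conductorNorm ℤ)) (hopt : Zhai2021.IsOptimalDatum c4087a1 Dt)
    (hL : ∃ x : ℚ, IsLAlg c4087a1 x ∧ x ≠ 0 ∧ padicValRat 2 x = 0)
    {d : ℤ} (hsqf : Squarefree d) (hd1 : d ≠ 1) (hd4 : d % 4 = 1) (hgcd : Int.gcd d 4087 = 1)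
    (hodd : ∀ q : ℕ, q.Prime → (q : ℤ) ∣ d → Odd (c4087a1.frobeniusTrace q))
    {c : VariableChange ℚ} (hc : c • c4087a1.quadraticTwist (d : ℚ) = W) :
    W.analyticRank = 0 ∧ W.mordellWeilRank = 0 ∧ AddCommGroup.primaryComponent W.sha 2 = ⊥ ∧ Odd W.tamagawaProduct ∧ BSDp W 2 := by
  have hE : hasEntireLFunction_rat := WeierstrassCurve.hasEntireLFunction_rat_of_exists_isNewformOf hmod
  have hr : c4087a1.analyticRank = 0 := by
    obtain ⟨x, hx, hx0, -⟩ := hL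
    exact analyticRank_eq_zero_of_isLAlg c4087a1 hE hx hx0
  exact bsdp_two_twist_oddTrace_of_print h11 h12 hMR' hmod hAU c4087a1 W Dt hopt (by rw [conductorNorm_4087a1]; norm_num) bad_4087a1
    irr_two_4087a1 Δ_4087a1_neg' (bsdp_two_4087a1_of_creutzMiller hCM hGZK hr) hL hsqf hd1 hd4 (by rwa [conductorNorm_4087a1]) hodd hc

/-! ## `4087c1` (`N = 61·67`, `Δ = −61·67`) -/

/-- The bad primes of `4087c1` are multiplicative with `ord_p Δ = 1`. [cite: CremonaAlgorithms1997, Table 1] -/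
theorem bad_4087c1 : ∀ (p : ℕ) [Fact p.Prime], p ∣ c4087c1.conductorNorm ℤ →
    c4087c1.HasMultiplicativeReductionAtPrime p ∧ Odd (padicValRat p c4087c1.Δ) := by
  intro p hp hpN
  rw [conductorNorm_4087c1, show (4087 : ℕ) = 61 * 67 by norm_num] at hpN
  have hΔ : c4087c1.Δ = ((-4087 : ℤ) : ℚ) := by
    rw [show c4087c1.Δ = ((M4087c1.Δ : ℤ) : ℚ) from baseChange_int_Δ M4087c1, M4087c1_Δ]
  rcases (Nat.Prime.dvd_mul hp.out).mp hpN with h | h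
  · have hp' : p = 61 := (Nat.prime_dvd_prime_iff_eq hp.out (by norm_num)).mp h
    subst hp'
    refine ⟨hasMultiplicativeReductionAtPrime_4087c1 61 (Or.inl rfl), ?_⟩
    rw [hΔ, show ((-4087 : ℤ) : ℚ) = -(((61 : ℕ) : ℚ) ^ 1 * (67 : ℕ)) by norm_num, padicValRat_neg_pow_mul 1 (by norm_num)]
    decide
  · have hp' : p = 67 := (Nat.prime_dvd_prime_iff_eq hp.out (by norm_num)).mp h
    subst hp'
    refine ⟨hasMultiplicativeReductionAtPrime_4087c1 67 (Or.inr rfl), ?_⟩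
    rw [hΔ, show ((-4087 : ℤ) : ℚ) = -(((67 : ℕ) : ℚ) ^ 1 * (61 : ℕ)) by norm_num, padicValRat_neg_pow_mul 1 (by norm_num)]
    decide

include h11 h12 hMR' hmod hAU hCM hGZK in
/-- **`BSD(W, 2)` PRINT-TRANSPORT on the whole `a_q`-odd twist class of `4087c1`** (`(d, 4087) = 1`), modulo PRINT⁷ + displayed {`Dt`, `hL`}.
No Kato, no certificate, no split condition. CONDITIONAL; BSD is NOT proved. [cite: Zhai2016, Thm. 1.1] [cite: MazurRubin2010, Lemma 2.10]
[cite: CreutzMiller2012, Thm. 1.1] [cite: AbbesUllmo1996, Thm. A] [cite: Miller2011LMS, Def. 1.1] -/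
theorem bsdp_two_twist_oddTrace_4087c1 [NeZero (c4087c1.conductorNorm ℤ)]
    (Dt : ModularParametrizationData c4087c1 (c4087c1.conductorNorm ℤ)) (hopt : Zhai2021.IsOptimalDatum c4087c1 Dt)
    (hL : ∃ x : ℚ, IsLAlg c4087c1 x ∧ x ≠ 0 ∧ padicValRat 2 x = 0)
    {d : ℤ} (hsqf : Squarefree d) (hd1 : d ≠ 1) (hd4 : d % 4 = 1) (hgcd : Int.gcd d 4087 = 1)
    (hodd : ∀ q : ℕ, q.Prime → (q : ℤ) ∣ d → Odd (c4087c1.frobeniusTrace q))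
    {c : VariableChange ℚ} (hc : c • c4087c1.quadraticTwist (d : ℚ) = W) :
    W.analyticRank = 0 ∧ W.mordellWeilRank = 0 ∧ AddCommGroup.primaryComponent W.sha 2 = ⊥ ∧ Odd W.tamagawaProduct ∧ BSDp W 2 := by
  have hE : hasEntireLFunction_rat := WeierstrassCurve.hasEntireLFunction_rat_of_exists_isNewformOf hmod
  have hr : c4087c1.analyticRank = 0 := by
    obtain ⟨x, hx, hx0, -⟩ := hL
    exact analyticRank_eq_zero_of_isLAlg c4087c1 hE hx hx0
  exact bsdp_two_twist_oddTrace_of_print h11 h12 hMR' hmod hAU c4087c1 W Dt hopt (by rw [conductorNorm_4087c1]; norm_num) bad_4087c1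
    irr_two_4087c1 Δ_4087c1_neg' (bsdp_two_4087c1_of_creutzMiller hCM hGZK hr) hL hsqf hd1 hd4 (by rwa [conductorNorm_4087c1]) hodd hc

/-! ## `2045b1` (`N = 5·409`, `Δ = −5¹⁷·409`; off the Kilford stratum) -/

/-- `Δ(2045b1) < 0`. [cite: CremonaAlgorithms1997, Table 1] -/
theorem Δ_2045b1_neg' : c2045b1.Δ < 0 := by
  rw [show c2045b1.Δ = ((M2045b1.Δ : ℤ) : ℚ) from baseChange_int_Δ M2045b1, M2045b1_Δ]; norm_num

/-- **Multiplicative reduction of `2045b1` at `5` and `409`** (`ℓ ∣ Δ`, `ℓ ∤ c₄ = 262569 = 3·87523`). [cite: SilvermanAEC2009, VII.5 Prop. 5.1(b)] -/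
theorem hasMultiplicativeReductionAtPrime_2045b1 (ℓ : ℕ) [Fact ℓ.Prime] (h : ℓ = 5 ∨ ℓ = 409) :
    c2045b1.HasMultiplicativeReductionAtPrime ℓ := by
  refine Summit.BirchSwinnertonDyer.BirchSwinnertonDyer.Rank1Residual.IntModel.hasMultiplicativeReductionAtPrime_of_intModel
    (Instances.integralModelInt_baseChange_int M2045b1) ℓ ?_ ?_
  · rw [M2045b1_Δ]; rcases h with rfl | rfl <;> norm_num
  · rw [M2045b1_c₄]; rcases h with rfl | rfl <;> norm_num

/-- The bad primes of `2045b1` are multiplicative with odd `ord_p Δ` (`17` at `5`, `1` at `409`). [cite: CremonaAlgorithms1997, Table 1] -/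
theorem bad_2045b1 : ∀ (p : ℕ) [Fact p.Prime], p ∣ c2045b1.conductorNorm ℤ →
    c2045b1.HasMultiplicativeReductionAtPrime p ∧ Odd (padicValRat p c2045b1.Δ) := by
  intro p hp hpN
  rw [conductorNorm_2045b1, show (2045 : ℕ) = 5 * 409 by norm_num] at hpN
  have hΔ : c2045b1.Δ = ((-312042236328125 : ℤ) : ℚ) := by
    rw [show c2045b1.Δ = ((M2045b1.Δ : ℤ) : ℚ) from baseChange_int_Δ M2045b1, M2045b1_Δ]
  rcases (Nat.Prime.dvd_mul hp.out).mp hpN with h | h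
  · have hp' : p = 5 := (Nat.prime_dvd_prime_iff_eq hp.out (by norm_num)).mp h
    subst hp'
    refine ⟨hasMultiplicativeReductionAtPrime_2045b1 5 (Or.inl rfl), ?_⟩
    rw [hΔ, show ((-312042236328125 : ℤ) : ℚ) = -(((5 : ℕ) : ℚ) ^ 17 * (409 : ℕ)) by norm_num,
      padicValRat_neg_pow_mul 17 (by norm_num)]
    decide
  · have hp' : p = 409 := (Nat.prime_dvd_prime_iff_eq hp.out (by norm_num)).mp h
    subst hp'
    refine ⟨hasMultiplicativeReductionAtPrime_2045b1 409 (Or.inr rfl), ?_⟩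
    rw [hΔ, show ((-312042236328125 : ℤ) : ℚ) = -(((409 : ℕ) : ℚ) ^ 1 * (762939453125 : ℕ)) by norm_num,
      padicValRat_neg_pow_mul 1 (by norm_num)]
    decide

include h11 h12 hMR' hmod hAU hCM hGZK in
/-- **`BSD(W, 2)` PRINT-TRANSPORT on the whole `a_q`-odd twist class of `2045b1`** (`(d, 2045) = 1`; off the Kilford stratum), modulo PRINT⁷ +
displayed {`Dt`, `hL`}. No Kato, no certificate, no split condition. CONDITIONAL; BSD is NOT proved. [cite: Zhai2016, Thm. 1.1]
[cite: MazurRubin2010, Lemma 2.10] [cite: CreutzMiller2012, Thm. 1.1] [cite: AbbesUllmo1996, Thm. A] [cite: Miller2011LMS, Def. 1.1] -/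
theorem bsdp_two_twist_oddTrace_2045b1 [NeZero (c2045b1.conductorNorm ℤ)]
    (Dt : ModularParametrizationData c2045b1 (c2045b1.conductorNorm ℤ)) (hopt : Zhai2021.IsOptimalDatum c2045b1 Dt)
    (hL : ∃ x : ℚ, IsLAlg c2045b1 x ∧ x ≠ 0 ∧ padicValRat 2 x = 0)
    {d : ℤ} (hsqf : Squarefree d) (hd1 : d ≠ 1) (hd4 : d % 4 = 1) (hgcd : Int.gcd d 2045 = 1)
    (hodd : ∀ q : ℕ, q.Prime → (q : ℤ) ∣ d → Odd (c2045b1.frobeniusTrace q))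
    {c : VariableChange ℚ} (hc : c • c2045b1.quadraticTwist (d : ℚ) = W) :
    W.analyticRank = 0 ∧ W.mordellWeilRank = 0 ∧ AddCommGroup.primaryComponent W.sha 2 = ⊥ ∧ Odd W.tamagawaProduct ∧ BSDp W 2 := by
  have hE : hasEntireLFunction_rat := WeierstrassCurve.hasEntireLFunction_rat_of_exists_isNewformOf hmod
  have hr : c2045b1.analyticRank = 0 := by
    obtain ⟨x, hx, hx0, -⟩ := hL
    exact analyticRank_eq_zero_of_isLAlg c2045b1 hE hx hx0
  exact bsdp_two_twist_oddTrace_of_print h11 h12 hMR' hmod hAU c2045b1 W Dt hopt (by rw [conductorNorm_2045b1]; norm_num) bad_2045b1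
    irr_two_2045b1 Δ_2045b1_neg' (bsdp_two_2045b1_of_creutzMiller hCM hGZK hr) hL hsqf hd1 hd4 (by rwa [conductorNorm_2045b1]) hodd hc

end Summit.BirchSwinnertonDyer.BirchSwinnertonDyer.Theorems.AlignedTransportAtTwoTwistFamilyZhaiTransportSeeds

end
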